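import Summits.MatrixMultiplication.OmegaCensus.DominoUniformZ4Z4Cells
import Summits.MatrixMultiplication.OmegaCensus.DominoPartFiveZ4Z4Cells
import Mathlib.NumberTheory.ArithmeticFunction.Misc
import HarnessLib

/-!
# Orders `3N + 1` with `Ω(N) ≤ 2`: no `|A| ≡ 1 (mod 3)` law over any `A ↠ ℤ₄ × ℤ₄`

ω-census `pub-omega`, family (b3), seat pub-omega-group gen 16.  Framing: lottery ticket; floor = certified bounds/negative
ranges.  VALUE: an infinite family of order lines of the Dih classification as ONE kernel theorem; NOT progress on ω.

By `no_mod_one_law_of_onto_z4z4_domino` (`DominoUniformZ4Z4Cells.lean`) a law triple over `A ↠ ℤ₄²` needs a factorisation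
`cde = (|A|−1)/3` with all parts `≥ 2` (and not `3·3·e`).  If `N = (|A|−1)/3` has at most two prime factors counted with
multiplicity — `N` prime, a prime squared, or a product of two primes — no such factorisation exists
(`exists_part_one_of_cardFactors_le_two`).  Hence:

* `no_mod_one_law_of_onto_z4z4_of_cardFactors_le_two` — `|A| = 3N + 1`, `Ω(N) ≤ 2`, `A ↠ ℤ₄²`: no dihedral-like group over `A`
  (any `c₀`) has a TPP triple attaining `3|S||T||U| + 8 = 8|A|`;
* `no_mod_one_law_of_onto_z4z4_prime_mul_prime` — the case `|A| = 3pq + 1` (`p, q` primes, possibly equal), which contains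
  the census orders `16, 64, 208, 256, 400, 640, 928, 1024, …` (`N = 5, 3·7, 3·23, 5·17, 7·19, 3·71, 3·103, 11·31`) and gen 14's
  prime family `|A| = 9p' + 1` only where `3p'` is a semiprime — together with `no_mod_one_law_of_onto_z4z4_prime` (gen 14)
  every order `3N + 1` with `Ω(N) ≤ 2` or `N = 9p'` is covered.
-/

namespace Summit.MatrixMultiplication.OmegaCensus

open Finset ArithmeticFunction
open scoped ArithmeticFunction.Omega

/-! ## Arithmetic -/

/-- A natural number `≥ 2` has at least one prime factor: `1 ≤ Ω n`. [folklore] -/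
theorem one_le_cardFactors_of_two_le {n : ℕ} (hn : 2 ≤ n) : 1 ≤ Ω n :=
  cardFactors_pos_iff_one_lt.2 (by omega)

/-- **If `cde = N` with `Ω(N) ≤ 2` and `N ≠ 0`, one of `c, d, e` is `1`.** [folklore] -/
theorem exists_part_one_of_cardFactors_le_two {c d e N : ℕ} (h : c * d * e = N) (hN : N ≠ 0) (hΩ : Ω N ≤ 2) :
    c = 1 ∨ d = 1 ∨ e = 1 := by
  by_contra hne
  push Not at hne
  obtain ⟨hc, hd, he⟩ := hne
  have hc0 : c ≠ 0 := fun h0 => hN (by rw [← h, h0]; ring)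
  have hd0 : d ≠ 0 := fun h0 => hN (by rw [← h, h0]; ring)
  have he0 : e ≠ 0 := fun h0 => hN (by rw [← h, h0]; ring)
  have h1 := one_le_cardFactors_of_two_le (n := c) (by omega)
  have h2 := one_le_cardFactors_of_two_le (n := d) (by omega)
  have h3 := one_le_cardFactors_of_two_le (n := e) (by omega)
  have hΩN : Ω N = Ω c + Ω d + Ω e := by
    rw [← h, cardFactors_mul (mul_ne_zero hc0 hd0) he0, cardFactors_mul hc0 hd0]
  omega

/-! ## The order family -/

section DihedralLike

variable {A : Type} [AddCommGroup A] [DecidableEq A] [Fintype A] {G : Type} [Group G] [DecidableEq G]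
  {ρ τ : A → G} {c₀ : A} {S T U : Finset G}

open Literature.Combinatorics.Additive

/-- **`|A| = 3N + 1` with `Ω(N) ≤ 2`, `A ↠ ℤ₄ × ℤ₄`: no dihedral-like group over `A` (any `c₀`) has a TPP triple attaining
`3|S||T||U| + 8 = 8|A|`.** [folklore] -/
theorem no_mod_one_law_of_onto_z4z4_of_cardFactors_le_two
    (hρρ : ∀ a b, ρ a * ρ b = ρ (a + b)) (hρτ : ∀ a b, ρ a * τ b = τ (b - a))
    (hτρ : ∀ a b, τ a * ρ b = τ (a + b)) (hττ : ∀ a b, τ a * τ b = ρ (c₀ + b - a))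
    (hρ : Function.Injective ρ) (hτ : Function.Injective τ) (hne : ∀ a b, ρ a ≠ τ b)
    (hsurj : ∀ g, (∃ a, ρ a = g) ∨ (∃ a, τ a = g)) {N : ℕ} (hA : Fintype.card A = 3 * N + 1) (hΩ : Ω N ≤ 2)
    (φ : A →+ ZMod 4 × ZMod 4) (hφ : Function.Surjective φ) (h : TripleProductProperty S T U) :
    3 * (S.card * T.card * U.card) + 8 ≠ 8 * Fintype.card A := by
  have h16 : 16 ∣ Fintype.card A := sixteen_dvd_card_of_onto_z4z4 φ hφ
  have hN0 : N ≠ 0 := by rintro rfl; omega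
  refine no_mod_one_law_of_onto_z4z4_domino hρρ hρτ hτρ hττ hρ hτ hne hsurj (by omega) φ hφ (fun c d e hcde => ?_) h
  exact Or.inl (exists_part_one_of_cardFactors_le_two (N := N) (by omega) hN0 hΩ)

/-- **`|A| = 3pq + 1` with `p, q` primes (possibly equal), `A ↠ ℤ₄ × ℤ₄`: no dihedral-like group over `A` (any `c₀`) has a
TPP triple attaining `3|S||T||U| + 8 = 8|A|.**  (Orders `16, 64, 208, 256, 400, 640, 928, 1024, 1312, …`.) [folklore] -/
theorem no_mod_one_law_of_onto_z4z4_prime_mul_prime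
    (hρρ : ∀ a b, ρ a * ρ b = ρ (a + b)) (hρτ : ∀ a b, ρ a * τ b = τ (b - a))
    (hτρ : ∀ a b, τ a * ρ b = τ (a + b)) (hττ : ∀ a b, τ a * τ b = ρ (c₀ + b - a))
    (hρ : Function.Injective ρ) (hτ : Function.Injective τ) (hne : ∀ a b, ρ a ≠ τ b)
    (hsurj : ∀ g, (∃ a, ρ a = g) ∨ (∃ a, τ a = g)) {p q : ℕ} (hp : p.Prime) (hq : q.Prime)
    (hA : Fintype.card A = 3 * (p * q) + 1)
    (φ : A →+ ZMod 4 × ZMod 4) (hφ : Function.Surjective φ) (h : TripleProductProperty S T U) :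
    3 * (S.card * T.card * U.card) + 8 ≠ 8 * Fintype.card A :=
  no_mod_one_law_of_onto_z4z4_of_cardFactors_le_two hρρ hρτ hτρ hττ hρ hτ hne hsurj hA
    (by rw [cardFactors_mul hp.ne_zero hq.ne_zero, cardFactors_apply_prime hp, cardFactors_apply_prime hq]) φ hφ h

/-- **`|A| = 3p + 1` with `p` prime, `A ↠ ℤ₄ × ℤ₄`** (orders `112, 160, 304, 448, 544, …`): no law — re-derived from the
uniform theorem (gen 14 proved the sharper-looking but equivalent-in-use family `9p + 1`). [folklore] -/
theorem no_mod_one_law_of_onto_z4z4_prime'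
    (hρρ : ∀ a b, ρ a * ρ b = ρ (a + b)) (hρτ : ∀ a b, ρ a * τ b = τ (b - a))
    (hτρ : ∀ a b, τ a * ρ b = τ (a + b)) (hττ : ∀ a b, τ a * τ b = ρ (c₀ + b - a))
    (hρ : Function.Injective ρ) (hτ : Function.Injective τ) (hne : ∀ a b, ρ a ≠ τ b)
    (hsurj : ∀ g, (∃ a, ρ a = g) ∨ (∃ a, τ a = g)) {p : ℕ} (hp : p.Prime) (hA : Fintype.card A = 3 * p + 1)
    (φ : A →+ ZMod 4 × ZMod 4) (hφ : Function.Surjective φ) (h : TripleProductProperty S T U) :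
    3 * (S.card * T.card * U.card) + 8 ≠ 8 * Fintype.card A :=
  no_mod_one_law_of_onto_z4z4_of_cardFactors_le_two hρρ hρτ hτρ hττ hρ hτ hne hsurj hA
    (by rw [cardFactors_apply_prime hp]; norm_num) φ hφ h

end DihedralLike

/-! ## An instance beyond `1000`: the order `1312 = 3·(19·23) + 1` -/

section Instances

variable {G : Type} [Group G] [DecidableEq G] {S T U : Finset G}

open Literature.Combinatorics.Additive

/-- **`ℤ₄ × ℤ₄ × ℤ₈₂` (order `1312 = 3·19·23 + 1`)**: no dihedral-like group over it (any `c₀`) has a TPP triple with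
`3|S||T||U| + 8 = 8·1312`. [folklore] -/
theorem no_mod_one_law_z4_z4_z82 {ρ τ : ZMod 4 × (ZMod 4 × ZMod 82) → G} {c₀ : ZMod 4 × (ZMod 4 × ZMod 82)}
    (hρρ : ∀ a b, ρ a * ρ b = ρ (a + b)) (hρτ : ∀ a b, ρ a * τ b = τ (b - a))
    (hτρ : ∀ a b, τ a * ρ b = τ (a + b)) (hττ : ∀ a b, τ a * τ b = ρ (c₀ + b - a))
    (hρ : Function.Injective ρ) (hτ : Function.Injective τ) (hne : ∀ a b, ρ a ≠ τ b)
    (hsurj : ∀ g, (∃ a, ρ a = g) ∨ (∃ a, τ a = g)) (h : TripleProductProperty S T U) :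
    3 * (S.card * T.card * U.card) + 8 ≠ 8 * Fintype.card (ZMod 4 × (ZMod 4 × ZMod 82)) :=
  no_mod_one_law_of_onto_z4z4_prime_mul_prime hρρ hρτ hτρ hττ hρ hτ hne hsurj (p := 19) (q := 23) (by norm_num)
    (by norm_num) (by simp) _ (z4_z4_zn_onto_z4z4 82) h

end Instances

end Summit.MatrixMultiplication.OmegaCensus
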